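import Summits.FinalStateConjecture.FinalStateConjecture.Theorems.StarvedNecksNecksCertifyStubSeamSurgeryOblate

/-!
# Route StarvedNecks — crux `NecksCertify`, line `two-cap-focusing-ledger`: seam surgery, the radial squash

Helper file for the registered stub `stub_seamSurgery` (N2): the RADIAL SQUASH of the far hole
leaves of one hole with spin `a`, built from the oblate scaling `P` of
`StarvedNecksNecksCertifyStubSeamSurgeryOblate` and a squash profile `g`
(`exists_squashProfile` of `…StubSeamSurgerySmoothing`, taken here as hypotheses).

* `exists_restSquash` (registered helper sub-goal `stub_seamSurgery_restSquash`) — for a smooth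
  monotone shell radius `b(t) > r₀ > 0` the squash `S x = P x (σ (x⁰) (r x))`,
  `σ t ρ = b t + g (ρ − b t)`: `S` preserves `t`, has Kerr–Schild radius `σ`, is the identity on
  `{r ≤ b(t)}`, is `C^∞` and injective on `{r > 0}`, open on `{r > r₀}` (explicit continuous
  inverse), and hits every point of radius `> r₀` below the squash ceiling; `σ` is the identity
  below `b`, strictly increasing in `ρ`, non-decreasing in `t` (slope of `g` at most one),
  continuous, with `b ≤ σ < b + 1/2` beyond `b`.
* `exists_labSquash` — the same map conjugated by the Poincaré map of a motion `(Λ, c)`, with all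
  clauses in terms of the rest-frame time and radius of `boostedKerrBackground Λ c M a`.

Mathlib + the landed seam helper modules; no definitions, no named facts.
-/

noncomputable section

open scoped Topology ContDiff
open Filter Set Function Literature.Geometry.Lorentzian

namespace Summit.FinalStateConjecture.FinalStateConjecture.Theorems.NecksCertifyTwoCap.Seam

set_option linter.dupNamespace false

open Summit.FinalStateConjecture.FinalStateConjecture.Theorems.NecksCertifyBargmann.Seam
  (eq_add_lorentz_poincareInv)

/-! ## The rest-frame radial squash -/

/-- **The rest-frame radial squash** (registered helper sub-goal `stub_seamSurgery_restSquash` of N2).  Let `a` be a spin, `r₀ > 0`, `b : ℝ → ℝ` a `C^∞` monotone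
shell radius with `b > r₀`, and `g` a squash profile (as provided by `exists_squashProfile`:
`C^∞`, strictly increasing, `g u = u` for `u ≤ 0`, `g < 1/2`, slope `≤ 1`, onto `(−∞, L)`).  Then
with `σ t ρ = b t + g (ρ − b t)` there is a map `S : E4 → E4` (namely `S x = P x (σ x⁰ (r_a x))`
with the oblate scaling `P`) which preserves the time coordinate, has Kerr–Schild radius
`σ x⁰ (r_a x)`, is the identity on `{r_a ≤ b(x⁰)}`, is `C^∞` and injective on `{r_a > 0}`, maps open
subsets of `{r_a > r₀}` to open sets, and hits every point of radius `> r₀` below the squash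
ceiling; `σ` is the identity below `b`, strictly increasing in `ρ`, non-decreasing in `t`,
continuous, with `b ≤ σ < b + 1/2` beyond `b`. [folklore] -/
theorem stub_seamSurgery_restSquash : ∀ (a r₀ : ℝ) (b : ℝ → ℝ) (g : ℝ → ℝ) (L : ℝ),
    0 < r₀ → ContDiff ℝ ∞ b → Monotone b → (∀ t, r₀ < b t) →
    ContDiff ℝ ∞ g → StrictMono g → (∀ u, u ≤ 0 → g u = u) →
    (∀ u, g u < 1 / 2) → (∀ u v, u ≤ v → g v - g u ≤ v - u) → (∀ u, g u < L) →
    (∀ y, y < L → ∃ u, g u = y) →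
    ∃ (σ : ℝ → ℝ → ℝ) (S : E4 → E4),
      (∀ t ρ, ρ ≤ b t → σ t ρ = ρ) ∧
      (∀ t, StrictMono (σ t)) ∧
      (∀ t ρ, σ t ρ < b t + 1 / 2) ∧
      (∀ t ρ, b t ≤ ρ → b t ≤ σ t ρ) ∧
      (∀ t t' ρ, t ≤ t' → σ t ρ ≤ σ t' ρ) ∧
      Continuous (fun p : ℝ × ℝ ↦ σ p.1 p.2) ∧
      (∀ t ρ, r₀ < ρ → r₀ < σ t ρ) ∧
      (∀ t ρ, b t ≤ ρ → σ t ρ ≤ ρ) ∧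
      (∀ x, S x 0 = x 0) ∧
      (∀ x, 0 < Kerr.radius a x → Kerr.radius a (S x) = σ (x 0) (Kerr.radius a x)) ∧
      (∀ x, 0 < Kerr.radius a x → Kerr.radius a x ≤ b (x 0) → S x = x) ∧
      ContDiffOn ℝ ∞ S {x | 0 < Kerr.radius a x} ∧
      InjOn S {x | 0 < Kerr.radius a x} ∧
      (∀ V : Set E4, IsOpen V → V ⊆ {x | r₀ < Kerr.radius a x} → IsOpen (S '' V)) ∧
      (∀ z, r₀ < Kerr.radius a z → (∃ ϱ, Kerr.radius a z < σ (z 0) ϱ) →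
        ∃ y, r₀ < Kerr.radius a y ∧ y 0 = z 0 ∧ S y = z) := by
  intro a r₀ b g L hr₀ hb hbm hbr hg hgm hgid hgb hgl hgL hgs
  obtain ⟨P, hP0, hPr, hPid, hPP, -, hPcd, hPinj, hPc⟩ := stub_seamSurgery_oblateScaling a
  -- the inverse profile
  set gi := Function.invFun g with hgi
  have hgi1 : ∀ u, gi (g u) = u := Function.leftInverse_invFun hgm.injective
  have hgi2 : ∀ y, y < L → g (gi y) = y := fun y hy ↦ Function.invFun_eq (hgs y hy)
  have hgi0 : ∀ v, v ≤ 0 → gi v = v := fun v hv ↦ by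
    conv_lhs => rw [← hgid v hv]
    exact hgi1 v
  have hgipos : ∀ v, 0 < v → v < L → 0 < gi v := fun v hv hvL ↦ by
    by_contra h
    push Not at h
    have := hgid (gi v) h
    rw [hgi2 v hvL] at this
    linarith
  have hg0 : g 0 = 0 := hgid 0 le_rfl
  have hgnn : ∀ u, 0 ≤ u → 0 ≤ g u := fun u hu ↦ by rw [← hg0]; exact hgm.monotone hu
  -- the radius profiles
  set σ : ℝ → ℝ → ℝ := fun t ρ ↦ b t + g (ρ - b t) with hσ
  set σ' : ℝ → ℝ → ℝ := fun t ρ ↦ b t + gi (ρ - b t) with hσ'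
  have hσ1 : ∀ t ρ, ρ ≤ b t → σ t ρ = ρ := fun t ρ h ↦ by
    simp only [hσ, hgid (ρ - b t) (by linarith)]; ring
  have hσ2 : ∀ t, StrictMono (σ t) := fun t ρ ρ' h ↦ by
    simp only [hσ]; linarith [hgm (show ρ - b t < ρ' - b t by linarith)]
  have hσ3 : ∀ t ρ, σ t ρ < b t + 1 / 2 := fun t ρ ↦ by simp only [hσ]; linarith [hgb (ρ - b t)]
  have hσ4 : ∀ t ρ, b t ≤ ρ → b t ≤ σ t ρ := fun t ρ h ↦ by
    simp only [hσ]; linarith [hgnn (ρ - b t) (by linarith)]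
  have hσ5 : ∀ t t' ρ, t ≤ t' → σ t ρ ≤ σ t' ρ := fun t t' ρ h ↦ by
    simp only [hσ]
    linarith [hgl (ρ - b t') (ρ - b t) (by linarith [hbm h]), hbm h]
  have hσc : Continuous (fun p : ℝ × ℝ ↦ σ p.1 p.2) :=
    (hb.continuous.comp continuous_fst).add
      (hg.continuous.comp (continuous_snd.sub (hb.continuous.comp continuous_fst)))
  have hσpos : ∀ t ρ, 0 < ρ → 0 < σ t ρ := fun t ρ hρ ↦ by
    rcases le_or_gt ρ (b t) with h | h
    · rwa [hσ1 t ρ h]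
    · linarith [hσ4 t ρ h.le, hbr t]
  have hσr₀ : ∀ t ρ, r₀ < ρ → r₀ < σ t ρ := fun t ρ hρ ↦ by
    rcases le_or_gt ρ (b t) with h | h
    · rwa [hσ1 t ρ h]
    · linarith [hσ4 t ρ h.le, hbr t]
  have hσ8 : ∀ t ρ, b t ≤ ρ → σ t ρ ≤ ρ := fun t ρ h ↦ by
    have := hgl 0 (ρ - b t) (by linarith)
    rw [hg0] at this
    simp only [hσ]; linarith
  have hσ'σ : ∀ t ρ, σ' t (σ t ρ) = ρ := fun t ρ ↦ by
    simp only [hσ, hσ', add_sub_cancel_left, hgi1]; ring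
  have hσσ' : ∀ t ρ, ρ - b t < L → σ t (σ' t ρ) = ρ := fun t ρ h ↦ by
    simp only [hσ, hσ', add_sub_cancel_left, hgi2 _ h]; ring
  have hσ'pos : ∀ t ρ, 0 < ρ → ρ - b t < L → 0 < σ' t ρ := fun t ρ hρ hL ↦ by
    rcases le_or_gt ρ (b t) with h | h
    · simp only [hσ', hgi0 (ρ - b t) (by linarith)]; linarith
    · have := hgipos (ρ - b t) (by linarith) hL
      simp only [hσ']; linarith [hbr t]
  have hσ'r₀ : ∀ t ρ, r₀ < ρ → ρ - b t < L → r₀ < σ' t ρ := fun t ρ hρ hL ↦ by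
    rcases le_or_gt ρ (b t) with h | h
    · simp only [hσ', hgi0 (ρ - b t) (by linarith)]; linarith
    · have := hgipos (ρ - b t) (by linarith) hL
      simp only [hσ']; linarith [hbr t]
  -- the squash and its inverse
  set S : E4 → E4 := fun x ↦ P x (σ (x 0) (Kerr.radius a x)) with hS
  set S' : E4 → E4 := fun y ↦ P y (σ' (y 0) (Kerr.radius a y)) with hS'
  have hS0 : ∀ x, S x 0 = x 0 := fun x ↦ hP0 _ _
  have hSr : ∀ x, 0 < Kerr.radius a x → Kerr.radius a (S x) = σ (x 0) (Kerr.radius a x) :=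
    fun x hx ↦ hPr _ _ hx (hσpos _ _ hx)
  have hS'S : ∀ x, 0 < Kerr.radius a x → S' (S x) = x := fun x hx ↦ by
    have h1 : S' (S x) = P (S x) (σ' (x 0) (σ (x 0) (Kerr.radius a x))) := by
      simp only [hS', hS0 x, hSr x hx]
    rw [h1, hσ'σ]
    simp only [hS]
    rw [hPP x _ _ hx (hσpos _ _ hx) hx, hPid x hx]
  have hSS' : ∀ y, 0 < Kerr.radius a y → Kerr.radius a y - b (y 0) < L → S (S' y) = y := by
    intro y hy hL
    have hρ' := hσ'pos (y 0) _ hy hL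
    have hr' : Kerr.radius a (S' y) = σ' (y 0) (Kerr.radius a y) := hPr _ _ hy hρ'
    have h0' : S' y 0 = y 0 := hP0 _ _
    have h1 : S (S' y) = P (S' y) (σ (y 0) (σ' (y 0) (Kerr.radius a y))) := by
      simp only [hS, h0', hr']
    rw [h1, hσσ' _ _ hL]
    simp only [hS']
    rw [hPP y _ _ hy hρ' hy, hPid y hy]
  refine ⟨σ, S, hσ1, hσ2, hσ3, hσ4, hσ5, hσc, hσr₀, hσ8, hS0, hSr, ?_, ?_, ?_, ?_, ?_⟩
  · -- identity below the shell
    intro x hx hxb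
    simp only [hS, hσ1 _ _ hxb, hPid x hx]
  · -- smoothness
    refine hPcd {x | 0 < Kerr.radius a x} (fun x ↦ σ (x 0) (Kerr.radius a x))
      (isOpen_lt continuous_const (Kerr.continuous_radius a)) (fun x hx ↦ hx)
      (fun x hx ↦ hσpos _ _ hx) ?_
    have h0 : ContDiff ℝ ∞ fun x : E4 ↦ x 0 := (EuclideanSpace.proj (0 : Fin 4) (𝕜 := ℝ)).contDiff
    have hrad : ContDiffOn ℝ ∞ (Kerr.radius a) {x | 0 < Kerr.radius a x} := fun x hx ↦
      (Kerr.contDiffAt_radius hx).contDiffWithinAt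
    exact ((hb.comp h0).contDiffOn).add (hg.comp_contDiffOn (hrad.sub (hb.comp h0).contDiffOn))
  · -- injectivity
    intro x hx x' hx' h
    have ht : x 0 = x' 0 := by rw [← hS0 x, ← hS0 x', h]
    have hr : Kerr.radius a x = Kerr.radius a x' := by
      have h1 := hSr x hx
      have h2 := hSr x' hx'
      rw [h] at h1
      rw [← ht] at h2
      exact (hσ2 (x 0)).injective (h1.symm.trans h2)
    refine hPinj x x' (σ (x 0) (Kerr.radius a x)) hx hr.symm (hσpos _ _ hx) ?_
    have : S x = S x' := h
    simp only [hS] at this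
    rwa [← ht, ← hr] at this
  · -- open map on `{r > r₀}`
    intro V hV hVr
    set W' : Set E4 := {y | r₀ < Kerr.radius a y ∧ Kerr.radius a y - b (y 0) < L} with hW'
    have hc0 : Continuous fun y : E4 ↦ y 0 := PiLp.continuous_apply 2 _ 0
    have hW'o : IsOpen W' := (isOpen_lt continuous_const (Kerr.continuous_radius a)).inter
      (isOpen_lt ((Kerr.continuous_radius a).sub (hb.continuous.comp hc0)) continuous_const)
    have hS'c : ContinuousOn S' W' := by
      refine hPc W' _ (fun y hy ↦ hr₀.trans hy.1) ?_
      refine ((hb.continuous.comp hc0).continuousOn).add ?_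
      refine (continuousOn_invFun_of_strictMono g L hgm hgs).comp
        (((Kerr.continuous_radius a).sub (hb.continuous.comp hc0)).continuousOn) fun y hy ↦ hy.2
    have heq : S '' V = W' ∩ S' ⁻¹' V := by
      ext y
      constructor
      · rintro ⟨x, hx, rfl⟩
        have hx0 : 0 < Kerr.radius a x := hr₀.trans (hVr hx)
        refine ⟨⟨?_, ?_⟩, ?_⟩
        · rw [hSr x hx0]; exact hσr₀ _ _ (hVr hx)
        · rw [hSr x hx0, hS0 x]; simp only [hσ]; linarith [hgL (Kerr.radius a x - b (x 0))]
        · show S' (S x) ∈ V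
          rwa [hS'S x hx0]
      · rintro ⟨hy, hyV⟩
        exact ⟨S' y, hyV, hSS' y (hr₀.trans hy.1) hy.2⟩
    rw [heq]
    exact hS'c.isOpen_inter_preimage hW'o hV
  · -- points below the ceiling are hit
    rintro z hz ⟨ϱ, hϱ⟩
    have hL' : Kerr.radius a z - b (z 0) < L := by
      simp only [hσ] at hϱ; linarith [hgL (ϱ - b (z 0))]
    have hz0 : 0 < Kerr.radius a z := hr₀.trans hz
    refine ⟨S' z, ?_, hP0 _ _, hSS' z hz0 hL'⟩
    rw [show Kerr.radius a (S' z) = σ' (z 0) (Kerr.radius a z) from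
      hPr _ _ hz0 (hσ'pos _ _ hz0 hL')]
    exact hσ'r₀ _ _ hz hL'

/-! ## The squash in the lab frame -/

/-- **The radial squash of a moving hole, in lab coordinates.**  Conjugating the rest-frame
squash by the Poincaré map of the motion `(Λ, c)`, `G y = c + Λ (S (Λ⁻¹(y − c)))`, gives a map
with the same properties stated in terms of the rest-frame Kerr–Schild time `t` and radius `r` of
`boostedKerrBackground Λ c M a`: `t (G y) = t y`, `r (G y) = σ (t y) (r y)`, `G = id` on
`{r ≤ b(t)}`, `C^∞` and injective on `{r > 0}`, open on `{r > r₀}`, onto below the ceiling.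
O'Neill 1983, Ch. 9, p. 236 (Poincaré maps). [folklore] -/
theorem exists_labSquash (Λ : lorentzGroup) (c : E4) (M a r₀ : ℝ) (b : ℝ → ℝ) (g : ℝ → ℝ)
    (L : ℝ) (hr₀ : 0 < r₀) (hb : ContDiff ℝ ∞ b) (hbm : Monotone b) (hbr : ∀ t, r₀ < b t)
    (hg : ContDiff ℝ ∞ g) (hgm : StrictMono g) (hgid : ∀ u, u ≤ 0 → g u = u)
    (hgb : ∀ u, g u < 1 / 2) (hgl : ∀ u v, u ≤ v → g v - g u ≤ v - u) (hgL : ∀ u, g u < L)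
    (hgs : ∀ y, y < L → ∃ u, g u = y) :
    ∃ (σ : ℝ → ℝ → ℝ) (G : E4 → E4),
      (∀ t ρ, ρ ≤ b t → σ t ρ = ρ) ∧
      (∀ t, StrictMono (σ t)) ∧
      (∀ t ρ, σ t ρ < b t + 1 / 2) ∧
      (∀ t ρ, b t ≤ ρ → b t ≤ σ t ρ) ∧
      (∀ t t' ρ, t ≤ t' → σ t ρ ≤ σ t' ρ) ∧
      Continuous (fun p : ℝ × ℝ ↦ σ p.1 p.2) ∧
      (∀ t ρ, r₀ < ρ → r₀ < σ t ρ) ∧ (∀ t ρ, b t ≤ ρ → σ t ρ ≤ ρ) ∧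
      (∀ y, (boostedKerrBackground Λ c M a).time (G y) = (boostedKerrBackground Λ c M a).time y) ∧
      (∀ y, 0 < (boostedKerrBackground Λ c M a).radius y →
        (boostedKerrBackground Λ c M a).radius (G y) =
          σ ((boostedKerrBackground Λ c M a).time y) ((boostedKerrBackground Λ c M a).radius y)) ∧
      (∀ y, 0 < (boostedKerrBackground Λ c M a).radius y →
        (boostedKerrBackground Λ c M a).radius y ≤ b ((boostedKerrBackground Λ c M a).time y) →
        G y = y) ∧
      ContDiffOn ℝ ∞ G {y | 0 < (boostedKerrBackground Λ c M a).radius y} ∧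
      InjOn G {y | 0 < (boostedKerrBackground Λ c M a).radius y} ∧
      (∀ V : Set E4, IsOpen V → V ⊆ {y | r₀ < (boostedKerrBackground Λ c M a).radius y} →
        IsOpen (G '' V)) ∧
      (∀ z, r₀ < (boostedKerrBackground Λ c M a).radius z →
        (∃ ϱ, (boostedKerrBackground Λ c M a).radius z <
          σ ((boostedKerrBackground Λ c M a).time z) ϱ) →
        ∃ y, r₀ < (boostedKerrBackground Λ c M a).radius y ∧
          (boostedKerrBackground Λ c M a).time y = (boostedKerrBackground Λ c M a).time z ∧
          G y = z) := by
  obtain ⟨σ, S, h1, h2, h3, h4, h5, h6, h7, h8, hS0, hSr, hSid, hScd, hSinj, hSop, hSsur⟩ :=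
    stub_seamSurgery_restSquash a r₀ b g L hr₀ hb hbm hbr hg hgm hgid hgb hgl hgL hgs
  set Λ' : E4 ≃L[ℝ] E4 := (Λ : E4 ≃L[ℝ] E4) with hΛ'
  set A : E4 → E4 := fun z ↦ c + Λ' z with hA
  set G : E4 → E4 := fun y ↦ A (S (poincareInv Λ c y)) with hG
  have hpA : ∀ z, poincareInv Λ c (A z) = z := fun z ↦ by
    simp [hA, poincareInv, hΛ']
  have hAp : ∀ y, A (poincareInv Λ c y) = y := fun y ↦ (eq_add_lorentz_poincareInv Λ c y).symm
  have hpG : ∀ y, poincareInv Λ c (G y) = S (poincareInv Λ c y) := fun y ↦ hpA _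
  have htime : ∀ y, (boostedKerrBackground Λ c M a).time y = poincareInv Λ c y 0 := fun _ ↦ rfl
  have hrad : ∀ y, (boostedKerrBackground Λ c M a).radius y = Kerr.radius a (poincareInv Λ c y) :=
    fun _ ↦ rfl
  have hAc : Continuous A := continuous_const.add Λ'.continuous
  have hAcd : ContDiff ℝ ∞ A := contDiff_const.add Λ'.contDiff
  have hpc : Continuous (poincareInv Λ c) := continuous_poincareInv Λ c
  have hpcd : ContDiff ℝ ∞ (poincareInv Λ c) :=
    (Λ'.symm : E4 →L[ℝ] E4).contDiff.comp (contDiff_id.sub contDiff_const)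
  have himA : ∀ W : Set E4, A '' W = poincareInv Λ c ⁻¹' W := fun W ↦ by
    ext y
    constructor
    · rintro ⟨z, hz, rfl⟩
      show poincareInv Λ c (A z) ∈ W
      rwa [hpA]
    · intro hy
      exact ⟨_, hy, hAp y⟩
  have himp : ∀ W : Set E4, poincareInv Λ c '' W = A ⁻¹' W := fun W ↦ by
    ext z
    constructor
    · rintro ⟨y, hy, rfl⟩
      show A (poincareInv Λ c y) ∈ W
      rwa [hAp]
    · intro hz
      exact ⟨_, hz, hpA z⟩
  refine ⟨σ, G, h1, h2, h3, h4, h5, h6, h7, h8, ?_, ?_, ?_, ?_, ?_, ?_, ?_⟩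
  · intro y
    rw [htime, htime, hpG, hS0]
  · intro y hy
    rw [hrad, htime, hrad, hpG]
    exact hSr _ hy
  · intro y hy hyb
    show A (S (poincareInv Λ c y)) = y
    rw [hSid _ hy hyb, hAp]
  · have hset : {y : E4 | 0 < (boostedKerrBackground Λ c M a).radius y} =
        poincareInv Λ c ⁻¹' {x | 0 < Kerr.radius a x} := rfl
    rw [hset]
    exact hAcd.comp_contDiffOn (hScd.comp hpcd.contDiffOn fun y hy ↦ hy)
  · intro y hy y' hy' h
    have h1 : S (poincareInv Λ c y) = S (poincareInv Λ c y') := by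
      have := congrArg (poincareInv Λ c) h
      rwa [hpG, hpG] at this
    have h2 : poincareInv Λ c y = poincareInv Λ c y' := hSinj hy hy' h1
    rw [← hAp y, ← hAp y', h2]
  · intro V hV hVr
    have hG' : G '' V = A '' (S '' (poincareInv Λ c '' V)) := by
      rw [← image_comp, ← image_comp]; rfl
    rw [hG', himA]
    refine (hSop _ ?_ ?_).preimage hpc
    · rw [himp]; exact hV.preimage hAc
    · rintro _ ⟨y, hy, rfl⟩; exact hVr hy
  · rintro z hz hϱ
    rw [hrad, htime] at *
    obtain ⟨x, hx, hx0, hxS⟩ := hSsur (poincareInv Λ c z) hz hϱ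
    refine ⟨A x, ?_, ?_, ?_⟩
    · rwa [hrad, hpA]
    · rw [htime, hpA, hx0]
    · show A (S (poincareInv Λ c (A x))) = z
      rw [hpA, hxS, hAp]

end Summit.FinalStateConjecture.FinalStateConjecture.Theorems.NecksCertifyTwoCap.Seam

end
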